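import Literature.NumberTheory.EllipticCurves.CofreeContinuousRepNewform
import Literature.NumberTheory.EllipticCurves.PrimaryTorsionGaloisRep
import Literature.NumberTheory.EllipticCurves.BigGaloisRepSelmer
import Literature.NumberTheory.GaloisRepresentations.ContinuousRepCoeffExtension
import Literature.NumberTheory.EllipticCurves.HidaFamilyMembers
import Literature.NumberTheory.EllipticCurves.GaloisAction
import HarnessLib

/-!
# Skinner 2016 §2.6 / §3.1 (a)–(b): the Hida members `g_m ≡ f (mod p^m)` of a `p`-new weight-2
# newform — for `f = f_E`, `p ∥ N`: a `p`-ordinary newform `g_m ∈ S_{k_m}(Γ₀(N/p))`, `k_m > 2`,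
# `k_m ≡ 2 (mod p − 1)`, with `T_{g_m}/p^m ≅ (T_pE ⊗ 𝒪)/p^m` as `𝒪[G_ℚ]`-modules (named fact F2 of
# the Road FF; the STRUCTURES `HidaCongruentForm ⊂ HidaCongruentMember` + ONE published existence fact)

Cell `bsd-stepL` (crux `stmt-BirchSwinnertonDyer-19270`, Road FF; typer lane `bsd-stepL-defn-ty1` g2;
SPEC-19270-RoadFF-facts-imc-p1-g8 §2 F2, design memo HOME/defn-ty1/MEMBER-FACTS-DESIGN-defn-ty1-g2.md).
These are the members (a)+(b) of the erratum's proof of Thm. 1.1 ([Castella2018Erratum] p. 4: "after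
possibly enlarging `𝒪`, for each `m ≥ 1` there exists (a) a `p`-ordinary newform `g_m ∈ S_{k_m}(Γ₀(M))`
defined over `𝒪` of weight `k_m > 2` with `k_m ≡ 2 (mod p − 1)`; (b) a `G_ℚ`-stable lattice
`T_{g_m} ⊂ V_{g_m}` and an isomorphism `T_{g_m}/p^m T_{g_m} ≃ T/p^m T` as `𝒪[G_ℚ]`-modules … Indeed, (a)
and (b) follow from Hida theory (see the discussion in [Ski16, §2.6])"), whose PUBLISHED source is
Skinner 2016 — the object feeding the kernel's `θ_m` (`BigRep.torsionRepIso_pow`, which consumes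
exactly the fields `e`/`he` below) and the member module `N_m = X^Σ_ac(A_{g_m})` (`BigGaloisRep.XBig κ
(Δ.cofreeRepOver K) 𝔭̄ Σ`, file `CofreeContinuousRepNewform`) of the coefficient-free descent
`AcSelmer.XAc.map_fittingIdeal_le_span_of_oneSided_congruences_descent_le_printed`.

## Source, verbatim (C. Skinner, *Multiplicative reduction and the cyclotomic main conjecture for
## GL₂*, Pacific J. Math. 283 (2016) 171–200; held text `paper:arxiv-1407.1093`, chunks p0011–p0013)

§2.6 (p0011 L62–p0012 L70): "Let `f ∈ S_k(Γ₀(N))` be a newform that is ordinary with respect to an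
embedding `ℚ(f) ↪ ℚ̄_p`. Write `N = p^r M` with `p ∤ M` … Let `L ⊂ ℚ̄_p` be any finite extension of `ℚ_p`
containing the image of `ℚ(f)` and let `𝒪` be the ring of integers of `L`. … if `φ : R → ℚ̄_p` is a
continuous `𝒪`-algebra homomorphism such that `φ(1 + X) = (1 + p)^{k'}` with `k' > 2` and
`k' ≡ k (mod p − 1)`, then `∑ φ(a_n)q^n` is the `q`-expansion of a `p`-stabilized newform, in the sense
that there is a newform `f_φ ∈ S_{k'}(Γ₀(M))` and an embedding `ℚ(f_φ) ↪ ℚ̄_p` such that `φ(a_ℓ) = a_ℓ(f_φ)`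
for all primes `ℓ ≠ p` and `φ(a_p)` is the unit root of the polynomial `x² − a_p(f_φ)x + p^{k'−1}` …
given any integer `m > 0`, there is an integer `r_m > 0` such that if `k' ≡ k (mod (p−1)p^{r_m})`, then
`φ_{k'} ≡ φ_0 (mod p^m 𝒪)`; in particular, for all primes `ℓ ≠ p`, `a_ℓ(f_{φ_{k'}}) ≡ a_ℓ(f) (mod p^m 𝒪)`.
For each integer `m` we choose such a `k' = k_m` and write `f_m` … we have chosen `k_m > 2` so that `f_m`
is a newform of level not divisible by `p` … Suppose that `ρ̄_f` is irreducible. Then … reduction modulo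
`p^m` induces identifications **(2-6-1)** `T_f/p^m T_f = 𝕋 ⊗_{R,φ_0} 𝒪/p^m 𝒪 = 𝕋 ⊗_{R,φ_m} 𝒪/p^m 𝒪 =
T_{f_m}/p^m T_{f_m}` as `𝒪[G_ℚ]`-modules." §3.1 (p0013 L12–L24): "Let `T_f ⊂ V_f` be a `G_ℚ`-stable
`𝒪`-lattice. By Lemma (lattice-lem) this lattice is unique up to `L^×`-multiple since `ρ̄_f` is assumed
irreducible. … After possibly replacing `L` with a finite extension, for each integer `m > 0` there exists
(a) a newform `f_m ∈ S_{k_m}(Γ₀(M))` with `ℚ(f_m) ⊂ L`, `k_m > 2`, and `k_m ≡ 2 (mod p − 1)` and such that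
`a_p(f_m) ∈ 𝒪^×`; (b) a `G_ℚ`-stable `𝒪`-lattice `T_{f_m} ⊂ V_{f_m}` and an isomorphism `T_f/p^m T_f ≅
T_{f_m}/p^m T_{f_m}` as `𝒪[G_ℚ]`-modules …. The forms `f_m` in (a) are just those defined in the
discussion of Hida families in Section 2.6. Then (b) is just (2-6-1)".

## Transcription (tree vocabulary only; nothing re-declared)

`f = f_E` for `E/ℚ` = a globally minimal `W` (`[W.IsElliptic] [W.IsGloballyMinimal]`), `p ∥ N`
(`W.HasMultiplicativeReductionAtPrime p`, so `r = 1`, `k = 2`, `M = N/p = W.conductorNorm ℤ / p` and `f`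
is ordinary), `ρ̄_f = E[p]` irreducible (`W.HasIrreducibleModPGaloisRep p`). A member at level `m` is the
structure `HidaCongruentMember W p m` (extending its newform part `HidaCongruentForm W p m`): the weight
`k` (`2 < k`, `(p − 1) ∣ (k − 2)`), the newform
`g ∈ S_k(Γ₀(N/p))` (`IsNewform0 g`, tree `Newforms.lean`), a `p`-adic embedding `ι : K_g → ℚ̄_p` of its
coefficient field with `|ι(a_p(g))|_p = 1` ("`a_p(f_m) ∈ 𝒪^×`"), the congruence of `q`-expansions
"`a_ℓ(f_m) ≡ a_ℓ(f) (mod p^m 𝒪)`" at the primes `ℓ ∤ N` (`|ι(a_ℓ(g)) − a_ℓ(E)|_p ≤ p^{−m}`, `a_ℓ(E) =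
W.frobeniusTrace ℓ`), an integral ordinary datum `Δ : GreenbergSelmer.OrdinaryNewformDatum g p ι`
(`ρ_g : Γ_ℚ → GL₂(𝒪)` attached to `(g, ι)` with its ordinary filtration; `𝒪 = padicCoeffIntegers ι`, the
integers of `K = ℚ_p(ι K_g)`; its discrete module `A_g = V_g/T_g = Cofree Δ.ρ K` with the continuous
action `Δ.cofreeRep`, file `CofreeContinuousRepNewform`), and THE CONGRUENCE (b) read on the discrete
modules (`A[p^m] ≅ T/p^m T` canonically by `x ↦ p^m x`): the EXISTENCE (field
`exists_equivariant_equiv`) of an `𝒪`-linear isomorphism `e : A_g[p^m] ≃ (E[p^∞] ⊗_{ℤ_p} 𝒪)[p^m]`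
(`Submodule.torsionBy`; abbreviations `MemberTorsion Δ m`, `CurveCoeffTorsion W ι m`, the `E`-side module
`CurveCoeffModule W ι = CoeffExtension ℤ_[p] 𝒪 (PrimaryTorsion (geomPoints W) p)` with the action
`curveCoeffRep W ι = (W.primaryTorsionGaloisRep p).extendScalars 𝒪`, file `ContinuousRepCoeffExtension`)
which is `G_ℚ`-EQUIVARIANT (through `BigGaloisRep.torsionRep`) — VERBATIM the hypothesis `h` of the
kernel's `BigRep.nonempty_torsionRepIso_pow m κ ρ ρ' h`; a chosen `D.e` with `D.he` (§3) is the pair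
`(e, he)` of `BigRep.torsionRepIso_pow m κ ρ ρ' e he`. The named fact
`skinner2016_exists_hidaCongruentMember` asserts `Nonempty (HidaCongruentMember W p m)` for every
`m ≥ 1` under `3 < p`, `p ∥ N`, `E[p]` irreducible.

## Flags (nothing hidden)

* `F2-own-ring` (COEFFICIENTS): print takes ONE finite `L/ℚ_p` containing all the `ℚ(f_m)` and the
  lattices over `𝒪_L`; the member here carries its OWN ring `𝒪_m = padicCoeffIntegers ι_m` (the integers
  of `ℚ_p(ι_m K_{g_m}) ⊆ L`), which is the currency of the tree's member objects (`OrdinaryNewformDatum`,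
  `cofreeRep`, `bigRep`, `XBig`) and of the consumer (`R'_m = 𝒪_m⟦T⟧`, per-`m` rings,
  `…descent_le_printed`; `ContinuousRepCoeffExtension` "Intended use"). The `𝒪_m`-form of (b) follows from
  the printed `𝒪_L`-form: both sides are free `𝒪/p^m`-modules of rank `2` with the same traces and
  residually ABSOLUTELY irreducible reduction `E[p]` (irreducible and odd, `p` odd), so they are
  isomorphic over `𝒪_m/p^m` by Carayol's rigidity theorem [Carayol1994, Thm. 1] (and the integral model of
  a residually absolutely irreducible representation is unique up to conjugation, EPW §3.1 = Skinner's
  Lemma (lattice-lem)). Hence the fact below is the CONJUNCTION of two published results — Skinner 2016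
  §3.1 (a)(b) and Carayol 1994 Thm. 1 — cited as such; it is not stronger than their conjunction.
* `F2-per-m` (QUANTIFIERS): print has `∃ L ∀ m`; the fact states `∀ m ∃ (member over its own ring)` —
  weaker.
* `F2-p-gt-3`: Skinner's §2.6 is stated for an ordinary newform and any `p` for which Hida's control
  theorem is available; the fact restricts to `p > 3` (the erratum's standing hypothesis `p > 3`, under
  which Hida 1986 / EPW Thm. 2.1.2 apply verbatim).
* `F2-A-side`: (b) is printed on lattices `T/p^m T`; typed on the discrete modules `A[p^m]`
  (`A[p^m] = p^{−m}T/T ≅ T/p^m T` canonically and `G_ℚ`-equivariantly) — the shape the kernel consumes.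

No `sorry`. ONE new named `Prop` (published; D-0014), two `structure`s (data), and — on the Literature
carrier `padicCoeffIntegers ι` — the canonical `ℤ_p`-algebra structure `ℤ_p → 𝒪 ⊆ K ⊇ ℚ_p`
(`padicCoeffIntegers.ofPadicInt`, needed to even write `E[p^∞] ⊗_{ℤ_p} 𝒪`; no Mathlib instance is
overridden or duplicated: the carrier is the tree's own subring).

## References

* [Skinner2016PacificMC] §2.6 (Hida families; (2-6-1)), §3.1 (a)(b) (p. 192); Lemma (lattice-lem).
* [Castella2018Erratum] proof of Thm. 1.1, (a)(b) (p. 4) — the consumer of this statement at `p ∥ N`.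
* [Carayol1994] H. Carayol, *Formes modulaires et représentations galoisiennes à valeurs dans un anneau
  local complet*, Contemp. Math. 165 (1994), Thm. 1 (rigidity) — flag `F2-own-ring`.
* [EmertonPollackWeston2006] §3.1 (p. 17) (`K`, `𝒪`, uniqueness of the integral model), Thm. 2.1.2
  (Hida); [Hida1986]. Tree: `HidaFamilyMembers.lean` (the mod-`p` members,
  `hida_exists_congruent_ordinary_newform_of_multiplicative`, same (a)-clauses),
  `GreenbergSelmerNewformDatum.lean`, `CofreeContinuousRepNewform.lean`, `PrimaryTorsionGaloisRep.lean`,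
  `ContinuousRepCoeffExtension.lean`, Summits consumer `Theorems/ErratumRoadFiveBigRepTorsionDefs.lean`.
-/

noncomputable section

open scoped MatrixGroups ModularForm TensorProduct
open CongruenceSubgroup Field UpperHalfPlane
open Literature.NumberTheory.GaloisRepresentations
open Literature.NumberTheory.EllipticCurves.ModularForms
open Literature.NumberTheory.EllipticCurves.BigGaloisRep

/-! ### §1. `𝒪 = padicCoeffIntegers ι` as a `ℤ_p`-algebra (`ℤ_p → ℚ_p → K`, norm `≤ 1`) -/

namespace Literature.NumberTheory.EllipticCurves.GreenbergSelmer

variable {Γ : Subgroup (GL (Fin 2) ℝ)} {k : ℤ} {g : CuspForm Γ k} {p : ℕ} [Fact p.Prime]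
  (ι : coeffField g →+* PadicAlgCl p)

/-- An element of `ℚ_p` lies in `K = ℚ_p(ι K_g)` (as `algebraMap ℚ_[p] K x`) and its image in `ℚ̄_p` is
`x` itself, of the same norm (`ℚ̄_p` is a normed `ℚ_p`-algebra). [cite: EmertonPollackWeston2006, §3.1 (p. 17, "`K` the finite extension of `ℚ_p` …")] -/
theorem norm_coe_algebraMap_padic (x : ℚ_[p]) :
    ‖((algebraMap ℚ_[p] (padicCoeffField ι) x : padicCoeffField ι) : PadicAlgCl p)‖ = ‖x‖ := by
  have h : ((algebraMap ℚ_[p] (padicCoeffField ι) x : padicCoeffField ι) : PadicAlgCl p) =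
      algebraMap ℚ_[p] (PadicAlgCl p) x := by
    rw [IsScalarTower.algebraMap_apply ℚ_[p] (padicCoeffField ι) (PadicAlgCl p)]
    rfl
  rw [h, norm_algebraMap']

/-- **The structure map `ℤ_p → 𝒪`**: `x ↦ x ∈ ℚ_p ⊆ K`, which has norm `‖x‖ ≤ 1`, i.e. lies in
`𝒪 = {y ∈ K : |y|_p ≤ 1}`. [cite: EmertonPollackWeston2006, §3.1 (p. 17, "`𝒪` the ring of integers of `K`")] -/
def padicCoeffIntegers.ofPadicInt : ℤ_[p] →+* padicCoeffIntegers ι :=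
  ((algebraMap ℚ_[p] (padicCoeffField ι)).comp PadicInt.Coe.ringHom).codRestrict (padicCoeffIntegers ι)
    fun x => by
      change ‖((algebraMap ℚ_[p] (padicCoeffField ι) (x : ℚ_[p]) : padicCoeffField ι) : PadicAlgCl p)‖ ≤ 1
      rw [norm_coe_algebraMap_padic]
      exact x.norm_le_one

/-- Unfolding `ofPadicInt` in `K`: `(ofPadicInt x : K) = algebraMap ℚ_[p] K x`.
[cite: EmertonPollackWeston2006, §3.1 (p. 17)] -/
@[simp] theorem padicCoeffIntegers.coe_ofPadicInt (x : ℤ_[p]) :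
    ((padicCoeffIntegers.ofPadicInt ι x : padicCoeffIntegers ι) : padicCoeffField ι) =
      algebraMap ℚ_[p] (padicCoeffField ι) (x : ℚ_[p]) :=
  rfl

/-- **`𝒪` is a `ℤ_p`-algebra** through `ofPadicInt` (the canonical structure `ℤ_p ⊆ 𝒪` of the ring of
integers of a finite extension `K/ℚ_p`; an instance on the tree's own carrier `padicCoeffIntegers ι`, no
Mathlib instance is overridden). Needed to form `E[p^∞] ⊗_{ℤ_p} 𝒪` (`CoeffExtension ℤ_[p] 𝒪 _`).
[cite: Skinner2016PacificMC, §2.6 ("`𝒪` the ring of integers of `L`", the `𝒪[G_ℚ]`-module `T_f`")] -/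
instance padicCoeffIntegers.algebraPadicInt : Algebra ℤ_[p] (padicCoeffIntegers ι) :=
  (padicCoeffIntegers.ofPadicInt ι).toAlgebra

/-- Unfolding the algebra map: `algebraMap ℤ_[p] 𝒪 = ofPadicInt`. [cite: EmertonPollackWeston2006, §3.1 (p. 17)] -/
theorem padicCoeffIntegers.algebraMap_padicInt_eq :
    algebraMap ℤ_[p] (padicCoeffIntegers ι) = padicCoeffIntegers.ofPadicInt ι :=
  rfl

end Literature.NumberTheory.EllipticCurves.GreenbergSelmer

/-! ### §2. The member structure and the named fact -/

namespace Literature.NumberTheory.EllipticCurves.Skinner2016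

open Literature.NumberTheory.EllipticCurves Literature.NumberTheory.EllipticCurves.GreenbergSelmer

variable {M : ℕ} {k : ℤ} {g : CuspForm (Gamma0 M) k} {p : ℕ} [Fact p.Prime]

/-- **`A_g[p^m]`** — the `p^m`-torsion of the member's discrete module `A_g = V_g/T_g = Cofree Δ.ρ K`
(`≅ T_g/p^m T_g` canonically), as an `𝒪`-submodule. [cite: Skinner2016PacificMC, §2.6 (2-6-1) ("`T_{f_m}/p^m T_{f_m}`")] -/
abbrev MemberTorsion {ι : coeffField g →+* PadicAlgCl p} (Δ : OrdinaryNewformDatum g p ι) (m : ℕ) :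
    Submodule (padicCoeffIntegers ι) (Cofree Δ.ρ (padicCoeffField ι)) :=
  Submodule.torsionBy (padicCoeffIntegers ι) (Cofree Δ.ρ (padicCoeffField ι))
    (((p : ℕ) : padicCoeffIntegers ι) ^ m)

/-- **`E[p^∞] ⊗_{ℤ_p} 𝒪`** — the `E`-side discrete module with coefficients extended to the member's ring
`𝒪 = padicCoeffIntegers ι` (`CoeffExtension`, file `ContinuousRepCoeffExtension`; `= (T_pE ⊗ 𝒪) ⊗ ℚ_p/ℤ_p`).
[cite: Skinner2016PacificMC, §2.6 ("`𝒪` the ring of integers of `L`", the `𝒪`-lattice `T_f`)] -/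
abbrev CurveCoeffModule (W : WeierstrassCurve ℚ) (ι : coeffField g →+* PadicAlgCl p) : Type :=
  CoeffExtension ℤ_[p] (padicCoeffIntegers ι) (PrimaryTorsion (WeierstrassCurve.geomPoints W) p)

/-- **`(E[p^∞] ⊗_{ℤ_p} 𝒪)[p^m]`** (`≅ (T_pE ⊗ 𝒪)/p^m = T_f/p^m T_f` canonically), as an `𝒪`-submodule.
[cite: Skinner2016PacificMC, §2.6 (2-6-1) ("`T_f/p^m T_f`")] -/
abbrev CurveCoeffTorsion (W : WeierstrassCurve ℚ) (ι : coeffField g →+* PadicAlgCl p) (m : ℕ) :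
    Submodule (padicCoeffIntegers ι) (CurveCoeffModule (p := p) W ι) :=
  Submodule.torsionBy (padicCoeffIntegers ι) (CurveCoeffModule (p := p) W ι)
    (((p : ℕ) : padicCoeffIntegers ι) ^ m)

/-- **The action `ρ_{E,p} ⊗ 1` of `Γ_ℚ` on `E[p^∞] ⊗_{ℤ_p} 𝒪`** (`ContinuousRep.extendScalars` of the tree's
`W.primaryTorsionGaloisRep p`; implicit arguments given explicitly — elaboration is otherwise slow).
[cite: Skinner2016PacificMC, §2.6 (2-6-1) ("as `𝒪[G_ℚ]`-modules")] -/
def curveCoeffRep (W : WeierstrassCurve ℚ) (ι : coeffField g →+* PadicAlgCl p) :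
    ContinuousRep (absoluteGaloisGroup ℚ) (padicCoeffIntegers ι) (CurveCoeffModule (p := p) W ι) :=
  ContinuousRep.extendScalars (R := ℤ_[p]) (G := absoluteGaloisGroup ℚ)
    (A := PrimaryTorsion (WeierstrassCurve.geomPoints W) p) (padicCoeffIntegers ι)
    (W.primaryTorsionGaloisRep p)

/-- Unfolding `curveCoeffRep`. [cite: Skinner2016PacificMC, §2.6 (2-6-1)] -/
theorem curveCoeffRep_def (W : WeierstrassCurve ℚ) (ι : coeffField g →+* PadicAlgCl p) :
    curveCoeffRep W ι =
      ContinuousRep.extendScalars (R := ℤ_[p]) (G := absoluteGaloisGroup ℚ)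
        (A := PrimaryTorsion (WeierstrassCurve.geomPoints W) p) (padicCoeffIntegers ι)
        (W.primaryTorsionGaloisRep p) :=
  rfl

/-- On pure tensors `c ⊗ P`: `σ · (c ⊗ P) = c ⊗ σP`. [cite: Skinner2016PacificMC, §2.6 (2-6-1)] -/
theorem curveCoeffRep_apply_tmul (W : WeierstrassCurve ℚ) (ι : coeffField g →+* PadicAlgCl p)
    (σ : absoluteGaloisGroup ℚ) (c : padicCoeffIntegers ι) (P : PrimaryTorsion (WeierstrassCurve.geomPoints W) p) :
    curveCoeffRep W ι σ (CoeffExtension.tmul c P) = CoeffExtension.tmul c (W.primaryTorsionGaloisRep p σ P) :=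
  ContinuousRep.extendScalars_apply_tmul _ _ σ c P

/-- **The newform part of a Hida member of `f_E` at level `m` (Skinner 2016 §3.1 (a) for `f = f_E`,
`p ∥ N`, with the congruence of `q`-expansions of §2.6 and EPW's integral ordinary datum; the erratum's
(a)).** DATA: a weight `k > 2` with `k ≡ 2 (mod p − 1)`; a newform `g ∈ S_k(Γ₀(N/p))`
(`N = W.conductorNorm ℤ`; "`f_m ∈ S_{k_m}(Γ₀(M))` … a newform of level not divisible by `p`"); a `p`-adic
embedding `ι` of its coefficient field with `|ι(a_p(g))|_p = 1` ("`a_p(f_m) ∈ 𝒪^×`") and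
`|ι(a_ℓ(g)) − a_ℓ(E)|_p ≤ p^{−m}` for every prime `ℓ ∤ N` ("`a_ℓ(f_{φ_{k'}}) ≡ a_ℓ(f) (mod p^m 𝒪)`", at
the good primes; `a_ℓ(E) = W.frobeniusTrace ℓ`); and an integral ordinary datum `Δ` for `(g, ι)` over
`𝒪 = padicCoeffIntegers ι` (the lattice `T_{f_m}` with its ordinary line and a uniformiser, EPW §3.1,
tree `OrdinaryNewformDatum`). A structure (data); nothing is asserted.
[cite: Skinner2016PacificMC, §2.6 and §3.1 (a) (p. 192)] [cite: Castella2018Erratum, proof of Thm. 1.1, (a) (p. 4)] -/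
structure HidaCongruentForm (W : WeierstrassCurve ℚ) [W.IsGloballyMinimal] (p : ℕ) [Fact p.Prime]
    (m : ℕ) where
  /-- the weight `k_m` -/
  k : ℤ
  /-- `k_m > 2` -/
  two_lt_k : 2 < k
  /-- `k_m ≡ 2 (mod p − 1)` -/
  dvd_k_sub_two : ((p : ℤ) - 1) ∣ (k - 2)
  /-- the member `g_m ∈ S_{k_m}(Γ₀(N/p))` -/
  g : CuspForm (Gamma0 (W.conductorNorm ℤ / p)) k
  /-- `g_m` is a newform (normalised new eigenform) of level `N/p` -/
  isNewform : ∀ [NeZero (W.conductorNorm ℤ / p)], IsNewform0 g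
  /-- a `p`-adic embedding of the coefficient field `K_{g_m}` -/
  ι : coeffField g →+* PadicAlgCl p
  /-- `g_m` is `ι`-ordinary: `|ι(a_p(g_m))|_p = 1` -/
  norm_coeff_p : ‖ι ⟨(qExpansion 1 ⇑g).coeff p, coeff_mem_coeffField g p⟩‖ = 1
  /-- `a_ℓ(g_m) ≡ a_ℓ(E) (mod p^m)` at every prime `ℓ ∤ N` -/
  norm_coeff_sub_le : ∀ ℓ : ℕ, ℓ.Prime → ¬ ℓ ∣ W.conductorNorm ℤ →
    ‖ι ⟨(qExpansion 1 ⇑g).coeff ℓ, coeff_mem_coeffField g ℓ⟩ - ((W.frobeniusTrace ℓ : ℤ) : PadicAlgCl p)‖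
      ≤ ((p : ℝ) ^ m)⁻¹
  /-- the integral ordinary datum `(ρ_{g_m}, T⁺, ϖ)` over `𝒪_m = padicCoeffIntegers ι` -/
  Δ : OrdinaryNewformDatum g p ι

/-- **A Hida member of `f_E` at level `m` (Skinner 2016 §3.1 (a)+(b) = §2.6 (2-6-1) for `f = f_E`,
`p ∥ N`, read on the discrete modules; the erratum's (a)+(b)).** The newform part `HidaCongruentForm`
TOGETHER WITH the congruence (b): THERE IS an `𝒪`-linear isomorphism `e : A_g[p^m] ≃ (E[p^∞] ⊗_{ℤ_p} 𝒪)[p^m]`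
("(b) … an isomorphism `T_f/p^m T_f ≅ T_{f_m}/p^m T_{f_m}` as `𝒪[G_ℚ]`-modules", `T_f = T_pE ⊗ 𝒪`;
`A[p^m] ≅ T/p^m T` canonically) which is `G_ℚ`-EQUIVARIANT for `A_g` with `Δ.cofreeRep` and `E[p^∞] ⊗ 𝒪`
with `ρ_{E,p} ⊗ 1 = curveCoeffRep W ι` (through `BigGaloisRep.torsionRep`). The field
`exists_equivariant_equiv` is VERBATIM the hypothesis `h` of the kernel's
`BigRep.nonempty_torsionRepIso_pow m κ ρ ρ' h` (`ρ = Δ.cofreeRep`, `ρ' = curveCoeffRep W ι`; over `Γ_K`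
after restriction: `⟨D.e, D.he_restrict K⟩`, §3), and a chosen `e` with its equivariance `he` is the input
of `BigRep.torsionRepIso_pow m κ ρ ρ' e he`. Flags `F2-own-ring`, `F2-A-side` (module docstring). A
structure; its existence is the named fact `skinner2016_exists_hidaCongruentMember`, not asserted here.
(Split parent/child so that each `structure` command elaborates within the default heartbeat budget.)
[cite: Skinner2016PacificMC, §2.6 (2-6-1) and §3.1 (a)(b) (p. 192)] [cite: Castella2018Erratum, proof of Thm. 1.1, (a)(b) (p. 4)] -/
structure HidaCongruentMember (W : WeierstrassCurve ℚ) [W.IsGloballyMinimal] (p : ℕ) [Fact p.Prime]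
    (m : ℕ) extends HidaCongruentForm W p m where
  /-- (b): an `𝒪`-linear `G_ℚ`-equivariant `A_{g_m}[p^m] ≃ (E[p^∞] ⊗_{ℤ_p} 𝒪)[p^m]` exists. -/
  exists_equivariant_equiv :
    ∃ e : MemberTorsion Δ m ≃ₗ[padicCoeffIntegers ι] CurveCoeffTorsion (p := p) W ι m,
      ∀ (σ : absoluteGaloisGroup ℚ) (a : MemberTorsion Δ m),
        (e (torsionRep Δ.cofreeRep (((p : ℕ) : padicCoeffIntegers ι) ^ m) σ a) :
            CurveCoeffModule (p := p) W ι) =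
          curveCoeffRep W ι σ (e a : CurveCoeffModule (p := p) W ι)

/-- **Skinner 2016, §3.1 (a)+(b) = §2.6 (2-6-1) (Hida theory), for `f = f_E` at a prime `p ∥ N`, with
Carayol's descent of the congruence to the member's own coefficient ring** (see the structures
`HidaCongruentForm`/`HidaCongruentMember` and the module docstring for the verbatim source and the flags
`F2-own-ring`, `F2-per-m`, `F2-p-gt-3`, `F2-A-side`): for a globally minimal elliptic `W/ℚ` of conductor
`N`, a prime `p > 3` of multiplicative reduction (`p ∥ N`, so `f_E` is a `p`-new `p`-ordinary weight-`2`
newform of level `N = pM`), with `E[p]` irreducible, and every `m ≥ 1`, THERE IS a Hida member at level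
`m`: a `p`-ordinary newform `g_m ∈ S_{k_m}(Γ₀(N/p))`, `k_m > 2`, `k_m ≡ 2 (mod p−1)`, congruent to `f_E`
modulo `p^m`, with `A_{g_m}[p^m] ≅ (E[p^∞] ⊗ 𝒪_m)[p^m]` as `𝒪_m[G_ℚ]`-modules. Named fact (D-0014);
nothing about `p`-adic `L`-functions or Selmer groups is asserted (those are (c) and (2.5)_m of the
erratum, separate statements).
[cite: Skinner2016PacificMC, §2.6 (2-6-1) and §3.1 (a)(b) (p. 192)] [cite: Carayol1994, Thm. 1 (rigidity: descent of (b) from `𝒪_L` to `𝒪_m`)]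
[cite: EmertonPollackWeston2006, Thm. 2.1.2 and §3.1 (p. 17)] -/
def skinner2016_exists_hidaCongruentMember : Prop :=
  ∀ (W : WeierstrassCurve ℚ) [W.IsElliptic] [W.IsGloballyMinimal] (p : ℕ) [Fact p.Prime],
    3 < p → W.HasMultiplicativeReductionAtPrime p → W.HasIrreducibleModPGaloisRep p →
    ∀ m : ℕ, 1 ≤ m → Nonempty (HidaCongruentMember W p m)

/-! ### §3. API (proved): what a member hands to the kernel -/

namespace HidaCongruentForm

variable {W : WeierstrassCurve ℚ} [W.IsGloballyMinimal] {p : ℕ} [Fact p.Prime] {m : ℕ}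
  (D : HidaCongruentForm W p m)

/-- The weight is at least `3`. [cite: Skinner2016PacificMC, §3.1 (a) ("`k_m > 2`")] -/
theorem three_le_k : 3 ≤ D.k := D.two_lt_k

/-- The member's coefficient ring `𝒪_m = padicCoeffIntegers ι_m`. [cite: Skinner2016PacificMC, §2.6 ("`𝒪` the ring of integers of `L`")] -/
abbrev coeffRing : Subring (padicCoeffField D.ι) := padicCoeffIntegers D.ι

/-- The member's discrete Galois module `A_{g_m} = V/T` with its continuous `Γ_ℚ`-action (`Δ.cofreeRep`).
[cite: Castella2018Erratum, §2 (p. 2, "`A_g := V_g/T_g`")] -/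
abbrev cofreeRep :
    ContinuousRep (absoluteGaloisGroup ℚ) (padicCoeffIntegers D.ι) (Cofree D.Δ.ρ (padicCoeffField D.ι)) :=
  D.Δ.cofreeRep

/-- The `E`-side with coefficients extended to the member's ring: `E[p^∞] ⊗_{ℤ_p} 𝒪_m` with the action
`ρ_{E,p} ⊗ 1` (`= curveCoeffRep W D.ι`). [cite: Skinner2016PacificMC, §2.6 (2-6-1) ("as `𝒪[G_ℚ]`-modules")] -/
abbrev curveRepExt :
    ContinuousRep (absoluteGaloisGroup ℚ) (padicCoeffIntegers D.ι) (CurveCoeffModule (p := p) W D.ι) :=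
  curveCoeffRep W D.ι

end HidaCongruentForm

namespace HidaCongruentMember

variable {W : WeierstrassCurve ℚ} [W.IsGloballyMinimal] {p : ℕ} [Fact p.Prime] {m : ℕ}
  (D : HidaCongruentMember W p m)

/-- **A chosen congruence isomorphism `e : A_{g_m}[p^m] ≃ₗ[𝒪_m] (E[p^∞] ⊗ 𝒪_m)[p^m]`** (the `e` of
`BigRep.torsionRepIso_pow m κ ρ ρ' e he`). [cite: Skinner2016PacificMC, §3.1 (b) (p. 192)] -/
def e : MemberTorsion D.Δ m ≃ₗ[padicCoeffIntegers D.ι] CurveCoeffTorsion (p := p) W D.ι m :=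
  D.exists_equivariant_equiv.choose

/-- **`e` is `G_ℚ`-equivariant** (the `he` of `BigRep.torsionRepIso_pow`).
[cite: Skinner2016PacificMC, §3.1 (b) (p. 192) ("as `𝒪[G_ℚ]`-modules")] -/
theorem he (σ : absoluteGaloisGroup ℚ) (a : MemberTorsion D.Δ m) :
    (D.e (torsionRep D.Δ.cofreeRep (((p : ℕ) : padicCoeffIntegers D.ι) ^ m) σ a) :
        CurveCoeffModule (p := p) W D.ι) =
      curveCoeffRep W D.ι σ (D.e a : CurveCoeffModule (p := p) W D.ι) :=
  D.exists_equivariant_equiv.choose_spec σ a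

/-- **The congruence restricted to `Γ_K`** for a number field `K` (the erratum works over `G_K ≤ G_ℚ`):
equivariance along `absGaloisRestrict ℚ K`, for `Δ.cofreeRepOver K` and the restricted `E`-side — so that
`⟨D.e, D.he_restrict K⟩` is the hypothesis `h` of `BigRep.nonempty_torsionRepIso_pow m κ
(D.Δ.cofreeRepOver K) ((curveCoeffRep W D.ι).restrict (absGaloisRestrict ℚ K))`.
[cite: Castella2018Erratum, proof of Thm. 1.1, (b) and Lemma 2.1 (pp. 2, 4)] -/
theorem he_restrict (K : Type) [Field K] [NumberField K] (σ : absoluteGaloisGroup K)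
    (a : MemberTorsion D.Δ m) :
    (D.e (torsionRep (D.Δ.cofreeRepOver K) (((p : ℕ) : padicCoeffIntegers D.ι) ^ m) σ a) :
        CurveCoeffModule (p := p) W D.ι) =
      ((curveCoeffRep W D.ι).restrict (absGaloisRestrict ℚ K)) σ
        (D.e a : CurveCoeffModule (p := p) W D.ι) :=
  D.he (absGaloisRestrict ℚ K σ) a

/-- The `∃`-form over `Γ_K` (hypothesis `h` of `BigRep.nonempty_torsionRepIso_pow`).
[cite: Castella2018Erratum, proof of Thm. 1.1, (b) (p. 4)] -/
theorem exists_equivariant_equiv_restrict (K : Type) [Field K] [NumberField K] :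
    ∃ e : MemberTorsion D.Δ m ≃ₗ[padicCoeffIntegers D.ι] CurveCoeffTorsion (p := p) W D.ι m,
      ∀ (σ : absoluteGaloisGroup K) (a : MemberTorsion D.Δ m),
        (e (torsionRep (D.Δ.cofreeRepOver K) (((p : ℕ) : padicCoeffIntegers D.ι) ^ m) σ a) :
            CurveCoeffModule (p := p) W D.ι) =
          ((curveCoeffRep W D.ι).restrict (absGaloisRestrict ℚ K)) σ
            (e a : CurveCoeffModule (p := p) W D.ι) :=
  ⟨D.e, D.he_restrict K⟩

end HidaCongruentMember

/-! ### §4. The same existence statement at Skinner's printed generality `p ≥ 3` (so at `p = 3`) -/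

/-- **Skinner 2016, §3.1 (a)+(b) = §2.6 (Hida theory), for `f = f_E` at a prime `p ∥ N`, at the
PRINTED generality `p ≥ 3`** — the sibling of `skinner2016_exists_hidaCongruentMember` with the binder
`3 < p` (flag `F2-p-gt-3`: the standing hypothesis of the CONSUMER [Castella2018Erratum], not of the
source) replaced by `3 ≤ p`, which is the generality printed by BOTH sources of the Hida-theoretic
input: Skinner 2016, §2 "Throughout `p` is a fixed odd prime" (arXiv:1407.1093 p. 5), Thm. A "Let
`p ≥ 3` be a prime" (p. 3), §2.6 "Hida proved that there is a finite, local `R₀`-domain `R` and a formal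
`q`-expansion … if `φ(1 + X) = (1 + p)^{k'}` with `k' > 2` and `k' ≡ k (mod p − 1)`, then `∑ φ(a_n)qⁿ` is
the `q`-expansion of a `p`-stabilized newform … `f_φ ∈ S_{k'}(Γ₀(M))`" (p. 11) and §3.1 (a)(b) (p. 13, in
the proof of Thm. A: "for each integer `m > 0` there exists (a) a newform `f_m ∈ S_{k_m}(Γ₀(M))` with
`ℚ(f_m) ⊂ L`, `k_m > 2`, and `k_m ≡ 2 (mod p−1)` … (b) a `G_ℚ`-stable `𝒪`-lattice `T_{f_m} ⊂ V_{f_m}` and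
an isomorphism `T_f/p^m T_f ≅ T_{f_m}/p^m T_{f_m}` as `𝒪[G_ℚ]`-modules"); Emerton–Pollack–Weston 2006,
Notation "We fix an odd prime `p`" (arXiv:math/0404484 p. 5) and Thm. 2.1.2 (Hida: the universal
ordinary Hecke algebra `𝕋_N` is free of finite rank over `Λ`, with classical specialisations at the
height-one primes of weight `k ≥ 2`). READING flag `F2-p-ge-3`: Skinner 2016 cites [GrSt], [Nek] in
§2.6 and no paper of Hida; this file transcribes the statement at the generality Skinner and EPW print
and does not adjudicate which published proof of Hida's control theorem covers `p = 3` (consumers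
needing that provenance cite EPW Thm. 2.1.2). Same flags `F2-own-ring`, `F2-per-m`, `F2-A-side` and the
same conjunction with Carayol's rigidity theorem (Thm. 1; for `p` odd, `E[p]` irreducible and odd is
absolutely irreducible) as the sibling. Statement: for a globally minimal elliptic `W/ℚ`, a prime
`p ≥ 3` of multiplicative reduction with `E[p]` irreducible, and every `m ≥ 1`, a Hida member at level
`m` exists (`Nonempty (HidaCongruentMember W p m)`). The sibling fact is its restriction to `3 < p`
(`skinner2016_exists_hidaCongruentMember_of_three_le`, proved); the instance `p = 3`
(`skinner2016_exists_hidaCongruentMember_three`, proved from it) is the input BY NAME of the UTD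
member-tower line at `p = 3` (crux `TwinSplitIMCAtThreeMult`; BSD is not advanced by typing it).
Named fact (D-0014); nothing about `p`-adic `L`-functions or Selmer groups is asserted.
[cite: Skinner2016PacificMC, §2 (p. 5, "p odd"), Thm. A (p. 3, "p ≥ 3"), §2.6 (2-6-1) and §3.1 (a)(b) (p. 192)]
[cite: EmertonPollackWeston2006, Notation (p. 5) and Thm. 2.1.2] [cite: Carayol1994, Thm. 1] -/
def skinner2016_exists_hidaCongruentMember_three_le : Prop :=
  ∀ (W : WeierstrassCurve ℚ) [W.IsElliptic] [W.IsGloballyMinimal] (p : ℕ) [Fact p.Prime],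
    3 ≤ p → W.HasMultiplicativeReductionAtPrime p → W.HasIrreducibleModPGaloisRep p →
    ∀ m : ℕ, 1 ≤ m → Nonempty (HidaCongruentMember W p m)

/-- The sibling fact (`3 < p`) is the restriction of the `p ≥ 3` statement (bookkeeping, proved).
[cite: Skinner2016PacificMC, §3.1 (a)(b) (p. 192)] -/
theorem skinner2016_exists_hidaCongruentMember_of_three_le
    (h : skinner2016_exists_hidaCongruentMember_three_le) : skinner2016_exists_hidaCongruentMember :=
  fun W _ _ p _ hp ↦ h W p hp.le

/-- **The instance `p = 3`**: for a globally minimal elliptic `W/ℚ` with multiplicative reduction at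
`3` and `E[3]` irreducible, and every `m ≥ 1`, a Hida member `g_m` (`3`-ordinary newform of level
`N/3`, weight `k_m > 2`, `k_m` even, `A_{g_m}[3^m] ≅ (E[3^∞] ⊗ 𝒪_m)[3^m]` `G_ℚ`-equivariantly) exists —
projection of `skinner2016_exists_hidaCongruentMember_three_le` (proved; `Fact (Nat.Prime 3)` is
Mathlib's instance). [cite: Skinner2016PacificMC, Thm. A (p. 3, "p ≥ 3") and §3.1 (a)(b) (p. 192)] -/
theorem skinner2016_exists_hidaCongruentMember_three
    (h : skinner2016_exists_hidaCongruentMember_three_le) (W : WeierstrassCurve ℚ) [W.IsElliptic]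
    [W.IsGloballyMinimal] (h3 : W.HasMultiplicativeReductionAtPrime 3)
    (hirr : W.HasIrreducibleModPGaloisRep 3) (m : ℕ) (hm : 1 ≤ m) :
    Nonempty (HidaCongruentMember W 3 m) :=
  h W 3 le_rfl h3 hirr m hm

end Literature.NumberTheory.EllipticCurves.Skinner2016

end
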